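import Mathlib
import Summits.Ventures.HodgeRepro2.T5ConductorArithmetic
import Summits.Ventures.HodgeRepro2.T6N5TateTwist
import Summits.Ventures.HodgeRepro2.T6N5Hyp
import Summits.Ventures.HodgeRepro2.T6N5LocalDatum
import Summits.Ventures.HodgeRepro2.T6N5LocalHyp
import Summits.Ventures.HodgeRepro2.T6N5Local
import Summits.Ventures.HodgeRepro2.T6N5LocalCharDatum
import Summits.Ventures.HodgeRepro2.T6N5LocalRamHyp

/-!
# T6N5LocalRam — Tier 6, M2 sub-step N5 (t6-p8's half): case (iii) of Theorem N5.T2 at a RAMIFIED place in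
kernel — the binder `hiii` of `N5Local_main` discharged from Tate's (3.2.6.3), Gan–Gross–Prasad's
Proposition 5.1 (2) and conductor arithmetic (TIER5 §N5.11.5 (iii-ramified), Lemma N5.L4 (ii)/(iv-c))

* `epsS_mul_of_isUnramified` — the unramified twist at `s = ½`: `ε(½, χω, ψ) = ε(½, χ, ψ)·ω(π^{n(ψ)+a(χ)})` for
  smooth `χ` and unramified `ω` (the display (3.2.6.3) applied to `χ ω_{1/2}`, with `a(χ ω_{1/2}) = a(χ)`).
* `eps_mul_mu` — LEMMA N5.L4 (ii) for the datum's `μ` (unramified, `μ(π) = −1`): `ε_v(χμ) = (−1)^{n(ψ_δ)+a(χ)} ε_v(χ)`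
  for smooth conjugate-symplectic `χ` — the sign transport needs `ε(½, χ, ψ_δ) = ±1`, which is Proposition 5.1 (2)
  (display) at the conjugate-inverse `ψ_δ`.
* `exists_isCS_odd` — LEMMA N5.L4 (iv-c): a conjugate-symplectic `χ₀` with `n(ψ_δ) + a(χ₀)` odd, from a
  conjugate-symplectic `ω̃` of odd conductor (N5.L4 (iv-a): `2t + 1`) and conjugate-orthogonal characters of even
  conductor above any bound (N5.L4 (iv-b): `β_{2k}`).
* `hiii_of_ramified` — THEOREM N5.T2 case (iii-ramified) in the pair form of `N5Local.localSolution_of_pair`: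
  `a := χ_s ∈ {χ₀, χ₀μ}` with `ε_v(χ_s) = s`, `c := χ_s μ` with `ε_v(c) = −s`, and `c⁻¹a² = χ_s μ⁻¹ = χ_s μ`
  (`μ² = 1`) so `ε_v(c⁻¹a²) = −s`.
* `N5Local_main_ramified` — THEOREM N5.T2 at a ramified place with `hiii` discharged.
Binder classes (TARGET-T6 §9.5): `hT6` PRINT (Tate (3.2.6.3)) · `hG` PRINT (GGP Prop. 5.1 (2)) · `hT` PRINT
(Tate (3.2.2)–(3.2.3), not consumed here but part of the datum's normalisation) · DATUM conditions: `hU`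
(antitone filtration), `hω` (`ω_{1/2}` unramified), `hconj` (`ψ_δ^σ = ψ_δ^{−1}`, N5.L6 (1)), `hμ`
(the unramified `μ` with `μ(π_E) = −1`: conjugate-orthogonal at a ramified place, `μ² = 1`), `hodd` (a
conjugate-symplectic character of odd conductor — N5.L4 (iv-a): the extension `ω̃` of `η_v` from
`F_v^× U_E^{2t+1}`, p4's `T5RamifiedCharacterInflation.exists_extension_of_eq_one_on_inf` p396935 on the
completions), `heven` (conjugate-orthogonal characters of even conductor above any bound — N5.L4 (iv-b), p4's
`T5ConductorExistenceInflated` / `T5RamifiedUnitIndex` rows) · `h35` PRINT · `hA1`, `hW`, `hη`, `hχW` as in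
`N5Local_main`.
README §8(d): uses an L-value-free non-vanishing device: NO.
-/

namespace Summit.Ventures.HodgeRepro2.T6.N5LocalRam

open Summit.Ventures.HodgeRepro2.T6.N5LocalDatum Summit.Ventures.HodgeRepro2.T6.N5TateTwist
  Summit.Ventures.HodgeRepro2.T5ConductorArithmetic Summit.Ventures.HodgeRepro2.T6.N5LocalCharDatum
  Summit.Ventures.HodgeRepro2.T6.N5LocalCharDatum.CharDatum
  Summit.Ventures.HodgeRepro2.T6.N5LocalRamDatum
  Summit.Ventures.HodgeRepro2.T6.N5Local Summit.Ventures.HodgeRepro2.T6.Hyp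

variable (R : RamifiedSignDatum)

/-- The unramified twist at `s = ½` (the display (3.2.6.3) applied to `χ ω_{1/2}`): for smooth `χ` and
unramified `ω`, `ε(½, χω, ψ) = ε(½, χ, ψ) · ω(π^{n(ψ) + a(χ)})`. -/
theorem epsS_mul_of_isUnramified (hT6 : Tate1979_3_2_6_3 R) (hU : Antitone R.U)
    (hω : R.IsUnramified (R.omega (1 / 2)))
    {χ ω : R.E →* ℂˣ} (hχ : R.IsSmooth χ) (hω0 : R.IsUnramified ω) (ψ : R.Psi) :
    R.tate.epsS (1 / 2) (χ * ω) ψ =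
      R.tate.epsS (1 / 2) χ ψ * ((ω (R.π ^ (R.n ψ + (R.cond χ : ℤ))) : ℂˣ) : ℂ) := by
  have hcomm : (χ * ω) * R.omega (1 / 2) = (χ * R.omega (1 / 2)) * ω := by
    ext x
    simp only [MonoidHom.mul_apply, mul_right_comm]
  change R.epsT ((χ * ω) * R.omega (1 / 2)) ψ (R.sd ψ) =
    R.epsT (χ * R.omega (1 / 2)) ψ (R.sd ψ) * _
  rw [hcomm, hT6 _ _ ψ (R.sd ψ) (isSmooth_mul R.toCharDatum hU hχ (isSmooth_of_isUnramified R.toCharDatum hω))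
    hω0, cond_mul_of_isUnramified R.toCharDatum hU hχ hω]

/-- `ε(½, χ, ψ_δ) = ±1` for conjugate-dual smooth `χ` (Proposition 5.1 (2) at the conjugate-inverse `ψ_δ`). -/
theorem epsS_eq_one_or_neg_one (hG : GGP2012_Prop5_1_2 R) (hconj : R.IsConjInv R.ψδ)
    {χ : R.E →* ℂˣ} (hχ : R.toLocalSignDatum.IsCS χ ∨ R.toLocalSignDatum.IsCO χ) (hs : R.IsSmooth χ) :
    R.tate.epsS (1 / 2) χ R.ψδ = 1 ∨ R.tate.epsS (1 / 2) χ R.ψδ = -1 := by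
  have h := hG R.ψδ hconj χ hχ hs
  have h' : (R.tate.epsS (1 / 2) χ R.ψδ - 1) * (R.tate.epsS (1 / 2) χ R.ψδ + 1) = 0 := by
    linear_combination h
  rcases mul_eq_zero.mp h' with h1 | h1
  · exact Or.inl (sub_eq_zero.mp h1)
  · exact Or.inr (add_eq_zero_iff_eq_neg.mp h1)

/-- LEMMA N5.L4 (ii) for the datum's `μ`: `ε_v(χμ) = ε_v(χ) · (−1)^{n(ψ_δ) + a(χ)}` for smooth
conjugate-symplectic `χ` and the unramified `μ` with `μ(π) = −1`. -/
theorem eps_mul_mu (hT6 : Tate1979_3_2_6_3 R) (hG : GGP2012_Prop5_1_2 R) (hU : Antitone R.U)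
    (hω : R.IsUnramified (R.omega (1 / 2))) (hconj : R.IsConjInv R.ψδ)
    {μ : R.E →* ℂˣ} (hμ0 : R.IsUnramified μ) (hμπ : ((μ R.π : ℂˣ) : ℂ) = -1)
    {χ : R.E →* ℂˣ} (hχ : R.toLocalSignDatum.IsCS χ) (hs : R.IsSmooth χ) :
    R.eps (χ * μ) = R.eps χ * Int.negOnePow (R.n R.ψδ + (R.cond χ : ℤ)) := by
  have hpm := epsS_eq_one_or_neg_one R hG hconj (Or.inl hχ) hs
  have hval : ((μ (R.π ^ (R.n R.ψδ + (R.cond χ : ℤ))) : ℂˣ) : ℂ) =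
      (-1 : ℂ) ^ (R.n R.ψδ + (R.cond χ : ℤ)) := by
    rw [map_zpow, Units.val_zpow_eq_zpow_val, hμπ]
  change toSign (R.tate.epsS (1 / 2) (χ * μ) R.ψδ) = toSign (R.tate.epsS (1 / 2) χ R.ψδ) * _
  rw [epsS_mul_of_isUnramified R hT6 hU hω hs hμ0, hval, toSign_mul_neg_one_zpow hpm]

/-- LEMMA N5.L4 (iv-c): a conjugate-symplectic smooth `χ₀` with `n(ψ_δ) + a(χ₀)` ODD, from a
conjugate-symplectic `ω̃` of odd conductor and conjugate-orthogonal characters of even conductor above any bound. -/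
theorem exists_isCS_odd (hU : Antitone R.U)
    (hodd : ∃ ωt : R.E →* ℂˣ, R.toLocalSignDatum.IsCS ωt ∧ R.IsSmooth ωt ∧ Odd (R.cond ωt))
    (heven : ∀ k : ℕ, ∃ β : R.E →* ℂˣ, R.toLocalSignDatum.IsCO β ∧ R.IsSmooth β ∧ Even (R.cond β) ∧
      k < R.cond β) :
    ∃ χ₀ : R.E →* ℂˣ, R.toLocalSignDatum.IsCS χ₀ ∧ R.IsSmooth χ₀ ∧ Odd (R.n R.ψδ + (R.cond χ₀ : ℤ)) := by
  obtain ⟨ωt, hωCS, hωs, hωodd⟩ := hodd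
  rcases Int.even_or_odd (R.n R.ψδ) with hn | hn
  · -- `n(ψ_δ)` even: `χ₀ := ωt` (odd conductor)
    refine ⟨ωt, hωCS, hωs, ?_⟩
    exact hn.add_odd (by exact_mod_cast hωodd)
  · -- `n(ψ_δ)` odd: `χ₀ := ωt β` with `β` conjugate-orthogonal of even conductor `> a(ωt)`
    obtain ⟨β, hβCO, hβs, hβeven, hβgt⟩ := heven (R.cond ωt)
    refine ⟨ωt * β, isCS_mul_of_isCO R.toCharDatum hωCS hβCO, isSmooth_mul R.toCharDatum hU hωs hβs, ?_⟩
    have hcomm : ωt * β = β * ωt := by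
      ext x
      simp only [MonoidHom.mul_apply, mul_comm]
    have hcond : R.cond (ωt * β) = R.cond β := by
      rw [hcomm]
      exact cond_mul_eq_of_lt R.toCharDatum hU hβs hωs hβgt
    rw [hcond]
    exact hn.add_even (by exact_mod_cast hβeven)

/-- A conjugate-symplectic smooth `χ_s` of the prescribed sign `s` with `n(ψ_δ) + a(χ_s)` odd: `χ₀` or `χ₀ μ`
(TIER5 (iii-ramified): «χ_s the element of {χ₀, χ₀μ} lying in C_s(v)»). -/
theorem exists_isCS_eps_eq (hT6 : Tate1979_3_2_6_3 R) (hG : GGP2012_Prop5_1_2 R) (hU : Antitone R.U)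
    (hω : R.IsUnramified (R.omega (1 / 2))) (hconj : R.IsConjInv R.ψδ)
    (hμ : ∃ μ : R.E →* ℂˣ, R.toLocalSignDatum.IsCO μ ∧ R.IsUnramified μ ∧ ((μ R.π : ℂˣ) : ℂ) = -1)
    (hχ₀ : ∃ χ₀ : R.E →* ℂˣ, R.toLocalSignDatum.IsCS χ₀ ∧ R.IsSmooth χ₀ ∧ Odd (R.n R.ψδ + (R.cond χ₀ : ℤ)))
    (s : ℤˣ) :
    ∃ χ : R.E →* ℂˣ, R.toLocalSignDatum.IsCS χ ∧ R.IsSmooth χ ∧ Odd (R.n R.ψδ + (R.cond χ : ℤ)) ∧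
      R.eps χ = s := by
  obtain ⟨μ, hμCO, hμ0, hμπ⟩ := hμ
  have hμs := isSmooth_of_isUnramified R.toCharDatum hμ0
  obtain ⟨χ₀, h₀CS, h₀s, h₀odd⟩ := hχ₀
  by_cases h : R.eps χ₀ = s
  · exact ⟨χ₀, h₀CS, h₀s, h₀odd, h⟩
  · have h' : R.eps χ₀ = -s := Int.units_ne_iff_eq_neg.mp h
    refine ⟨χ₀ * μ, isCS_mul_of_isCO R.toCharDatum h₀CS hμCO, isSmooth_mul R.toCharDatum hU h₀s hμs, ?_, ?_⟩
    · rw [cond_mul_of_isUnramified R.toCharDatum hU h₀s hμ0]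
      exact h₀odd
    · rw [eps_mul_mu R hT6 hG hU hω hconj hμ0 hμπ h₀CS h₀s, h', Int.negOnePow_odd _ h₀odd, neg_mul,
        mul_neg_one, neg_neg]

/-- THEOREM N5.T2, CASE (iii) AT A RAMIFIED PLACE (TIER5 §N5.11.5 (iii-ramified)) in the pair form of
`N5Local.localSolution_of_pair`: `a := χ_s` (conjugate-symplectic, `ε_v = s`, `n(ψ_δ) + a(χ_s)` odd) and
`c := χ_s μ` (`ε_v = −s` by Lemma N5.L4 (ii)); `c⁻¹a² = χ_s μ⁻¹ = χ_s μ` since `μ² = 1`, so `ε_v(c⁻¹a²) = −s`. -/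
theorem hiii_of_ramified (hT6 : Tate1979_3_2_6_3 R) (hG : GGP2012_Prop5_1_2 R) (hU : Antitone R.U)
    (hω : R.IsUnramified (R.omega (1 / 2))) (hconj : R.IsConjInv R.ψδ)
    (hμ : ∃ μ : R.E →* ℂˣ, R.toLocalSignDatum.IsCO μ ∧ R.IsUnramified μ ∧ ((μ R.π : ℂˣ) : ℂ) = -1 ∧
      μ * μ = 1)
    (hodd : ∃ ωt : R.E →* ℂˣ, R.toLocalSignDatum.IsCS ωt ∧ R.IsSmooth ωt ∧ Odd (R.cond ωt))
    (heven : ∀ k : ℕ, ∃ β : R.E →* ℂˣ, R.toLocalSignDatum.IsCO β ∧ R.IsSmooth β ∧ Even (R.cond β) ∧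
      k < R.cond β) :
    ∃ a c : R.E →* ℂˣ, R.toLocalSignDatum.IsCS a ∧ R.toLocalSignDatum.IsCS c ∧
      R.eps a = R.ηLine 0 ∧ R.eps c = -R.ηLine 0 ∧ R.eps (c⁻¹ * a * a) = -R.ηLine 0 := by
  obtain ⟨μ, hμCO, hμ0, hμπ, hμsq⟩ := hμ
  obtain ⟨a, haCS, has, haodd, haeps⟩ := exists_isCS_eps_eq R hT6 hG hU hω hconj
    ⟨μ, hμCO, hμ0, hμπ⟩ (exists_isCS_odd R hU hodd heven) (R.ηLine 0)
  have hμinv : ∀ x : R.E, (μ x)⁻¹ = μ x := by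
    intro x
    have hx : μ x * μ x = 1 := by
      have := congrArg (fun f : R.E →* ℂˣ => f x) hμsq
      simpa [MonoidHom.mul_apply] using this
    exact inv_eq_of_mul_eq_one_right hx
  have hq : (a * μ)⁻¹ * a * a = a * μ := by
    ext x
    simp only [MonoidHom.mul_apply, MonoidHom.inv_apply]
    rw [mul_inv, hμinv, mul_right_comm ((a x)⁻¹) (μ x) (a x), inv_mul_cancel, one_mul, mul_comm]
  have hc : R.eps (a * μ) = -R.ηLine 0 := by
    rw [eps_mul_mu R hT6 hG hU hω hconj hμ0 hμπ haCS has, haeps, Int.negOnePow_odd _ haodd, mul_neg_one]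
  refine ⟨a, a * μ, haCS, isCS_mul_of_isCO R.toCharDatum haCS hμCO, haeps, hc, ?_⟩
  rw [hq, hc]

/-- THEOREM N5.T2 (`N5Local.N5Local_main`) at a ramified place with case (iii) discharged. -/
theorem N5Local_main_ramified (hT6 : Tate1979_3_2_6_3 R) (hG : GGP2012_Prop5_1_2 R) (hU : Antitone R.U)
    (hω : R.IsUnramified (R.omega (1 / 2))) (hconj : R.IsConjInv R.ψδ)
    (hμ : ∃ μ : R.E →* ℂˣ, R.toLocalSignDatum.IsCO μ ∧ R.IsUnramified μ ∧ ((μ R.π : ℂˣ) : ℂ) = -1 ∧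
      μ * μ = 1)
    (hodd : ∃ ωt : R.E →* ℂˣ, R.toLocalSignDatum.IsCS ωt ∧ R.IsSmooth ωt ∧ Odd (R.cond ωt))
    (heven : ∀ k : ℕ, ∃ β : R.E →* ℂˣ, R.toLocalSignDatum.IsCO β ∧ R.IsSmooth β ∧ Even (R.cond β) ∧
      k < R.cond β)
    (h35 : BFGYYZ2025_Thm3_5 R.toLocalSignDatum)
    (hA1 : ∀ s : ℤˣ, ∃ α : R.E →* ℂˣ, R.toLocalSignDatum.IsCO α ∧ R.toLocalSignDatum.Theta s α)
    (hW : R.toLocalSignDatum.epsdW = 1) (hη : R.toLocalSignDatum.η * R.toLocalSignDatum.η = 1)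
    (hχW : R.toLocalSignDatum.IsCS R.toLocalSignDatum.χW) :
    ∃ ξ : Fin 4 → R.E →* ℂˣ, LocalSolution R.toLocalSignDatum ξ :=
  N5Local_main R.toLocalSignDatum h35 hA1 hW hη hχW
    (fun _ _ => hiii_of_ramified R hT6 hG hU hω hconj hμ hodd heven)

end Summit.Ventures.HodgeRepro2.T6.N5LocalRam
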